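import Mathlib.LinearAlgebra.Matrix.GeneralLinearGroup.Card
import Mathlib.Algebra.Ring.GeomSum
import Mathlib.Algebra.BigOperators.Intervals
import Mathlib.Data.Fintype.Perm
import Mathlib.Data.Nat.Factorial.BigOperators
import Mathlib.Analysis.Complex.Basic
import Literature.LinearAlgebra.Subspace.GaussianBinomialCount
import HarnessLib

/-!
# `#GL(n, 𝔽_q) = (q − 1)ⁿ q^{(n²−n)/2} [n]_q!` and Tits' limit `lim_{q→1} #GL(n,𝔽_q)/#T = n! = #S_n` (Lorscheid 2018, §1.1.2)

Topic `LinearAlgebra/Matrix`; everything here is PROVED (Mathlib + elementary algebra), no named fact.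
Companion of `Literature.LinearAlgebra.Subspace.GaussianBinomialCount` (Cohn 2004: the number of
`k`-subspaces of `𝔽_qⁿ` is the Gauss binomial, `= (n choose k)` at `q = 1`), whose docstring lists as
"NOT here" the Gauss factorial `[n]_q!` and Tits' `q → 1` statement `n! = |S_n|`; this file supplies the
GROUP half of that heuristic exactly as printed in [Lorscheid2018, §1.1.2 "The limit geometry"]:

"`[n]_q = Σ_{i=0}^{n−1} q^i`, `[n]_q! = ∏_{i=1}^{n} [i]_q` … called the Gauss number, the Gauss factorial
… Note that we recover the classical quantities in the limit `q → 1`: `lim_{q→1} [n]_q = n`,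
`lim_{q→1} [n]_q! = n!` … The elements of `G = GL(n, 𝔽_q)` correspond to ordered bases of `𝔽_qⁿ` …
Therefore we have `#GL(n, 𝔽_q) = ∏_{i=1}^{n} (qⁿ − q^{i−1}) = ∏_{i=1}^{n} (q−1) q^{i−1} [i]_q
= (q−1)ⁿ q^{(n²−n)/2} [n]_q!` … Note that the limit `q → 1` of the cardinalities of `G` and `P_k` is `0`
due to the term `(q−1)ⁿ`.  But if we resolve this zero, i.e. if we divide by `#T = (q−1)ⁿ`, then we
obtain `lim_{q→1} #G/#T = #S_n` … Based on these observations, Tits dreamt about the existence of a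
geometry over a field `𝔽₁` with one element … summarized in hypothetical formulas such as
`GL(n, 𝔽₁) = S_n`."

## Statements

* `gaussNumber q m = Σ_{i<m} q^i` (`[m]_q`), `gaussFactorial q n = ∏_{i<n} [i+1]_q` (`[n]_q!`), over any
  commutative semiring; `gaussNumber_one : [m]_1 = m`, `gaussFactorial_one : [n]_1! = n!`
  ("`lim_{q→1} [n]_q! = n!`" as the value of the polynomial at `1`); cast lemmas.
* `prod_pow_sub_pow_eq_gaussFactorial` (any commutative ring):
  `∏_{i<n} (qⁿ − q^i) = (q−1)ⁿ · q^{n(n−1)/2} · [n]_q!` — Lorscheid's display, from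
  `qⁿ − q^i = (q−1) q^i [n−i]_q` (`pow_sub_pow_eq_mul_gaussNumber`, the geometric sum).
* `card_GL_eq_gaussFactorial` (finite field `𝔽`, `q = #𝔽`): `#GL(n, 𝔽) = (q−1)ⁿ q^{n(n−1)/2} [n]_q!`
  in `ℕ`, from Mathlib's `Matrix.card_GL_field` (`= ∏ (qⁿ − q^i)`, the ordered-bases count).
* `card_diagonalTorus : #(𝔽ˣ)ⁿ = (q−1)ⁿ` (`#T`) and `card_GL_div_card_torus`:
  `#GL(n, 𝔽) / #T = q^{n(n−1)/2} [n]_q!` (exact division in `ℕ`).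
* `tendsto_pow_mul_gaussFactorial_card_perm`: `lim_{x→1} x^{n(n−1)/2} [n]_x! = #S_n` (`= n!`,
  `Fintype.card_perm`) as a limit of the real polynomial function — "`lim_{q→1} #G/#T = #S_n`", i.e.
  Tits' `GL(n, 𝔽₁) = S_n` in the only sense in which it is a theorem.
* §5 (bridge to the tree's Gauss binomial and flag count): `gaussNumber_eq_qBinomial`
  (`[m]_q = [m choose 1]_q` for `Literature.Combinatorics.Enumerative.qBinomial`),
  `gaussFactorial_eq_prod_qBinomial` (`[n]_q! = ∏_{i<n} [i+1 choose 1]_q`, the product in which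
  `Literature.LinearAlgebra.Subspace.card_completeFlag_fin_eq_prod` counts complete flags), hence
  `card_GL_eq_card_borel_mul_card_completeFlag`:
  `#GL(n, 𝔽_q) = (q−1)ⁿ q^{n(n−1)/2} · #{complete flags of 𝔽_qⁿ}` — Lorscheid's "dividing" step
  `#(G/P) = #G/#P` for `P = B` in multiplied-out form, with `#B = #T · q^{n(n−1)/2}`.

## What is NOT here

The flag count `#(GL_n/B)(𝔽_q) = [n]_q!` is `card_completeFlag_fin_eq_prod` of `GaussianBinomialCount` (§3
there; used in §5 here) and `#Gr(k, 𝔽_qⁿ) = [n choose k]_q` is its `card_finrank_eq_qBinomial`; NOT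
formalised anywhere: the Borel subgroup `B` as a subgroup with `#B(𝔽_q) = (q−1)ⁿ q^{n(n−1)/2}` and the
orbit–stabiliser bijection `GL_n/B ≃ {flags}` themselves (§5 is the resulting COUNT identity only), the
parabolic counts `#P_k`, the Weyl-group isomorphism `N_G(T)/T ≅ S_n`, and the Bruhat-cell expansion
`[n]_q! = Σ_{w ∈ S_n} q^{ℓ(w)}`.

## References

* [Lorscheid2018] O. Lorscheid, *`𝔽₁` for everyone*, Jahresber. Dtsch. Math.-Ver. 120 (2018) 83–116 =
  arXiv:1801.05337, §1 (p. 4: "`GL(n, 𝔽_q) ⟶[q→1] GL(n, 𝔽₁) = S_n`") and §1.1.2 (the displays quoted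
  above) — read in the arXiv text.  Lorscheid attributes the observation to J. Tits, *Sur les analogues
  algébriques des groupes semi-simples complexes* (1957) [Lorscheid2018, §1, ref. Tits57].
* [Cohn2004] H. Cohn, *Projective geometry over `𝔽₁` and the Gaussian binomial coefficients*, Amer.
  Math. Monthly 111 (2004) — the subspace half, formalised in `GaussianBinomialCount`.

## Design notes

* `gaussNumber`/`gaussFactorial` are plain finite sums/products (no recursion), so that the `ℕ`-valued
  and ring-valued versions agree under `Nat.cast` by `simp`, and the real-variable version is visibly a
  polynomial function (continuity by `fun_prop`).  They are this file's names for Lorscheid's `[n]_q`,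
  `[n]_q!`; the tree's `Literature.Combinatorics.Enumerative.qBinomial` (Gauss binomial by the `q`-Pascal
  rule) is not needed here and is not restated.
* Mathlib/tree searches (2026-08-20): `card_GL_field` (Mathlib, used), `qFactorial` (only the unrelated
  truncated quantum factorial of `RepresentationTheory/ModularTensorCategories`), `gaussFactorial`,
  `q-factorial`, `[n]_q!` under `Literature/` — absent.
-/

noncomputable section

open Finset

namespace Literature.LinearAlgebra.Matrix

/-! ## §1. Gauss numbers and Gauss factorials -/

section GaussFactorial

variable {R : Type*} [CommSemiring R]

/-- The **Gauss number** `[m]_q = Σ_{i=0}^{m−1} q^i`. [cite: Lorscheid2018, §1.1.2] -/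
def gaussNumber (q : R) (m : ℕ) : R :=
  ∑ i ∈ range m, q ^ i

/-- The **Gauss factorial** `[n]_q! = ∏_{i=1}^{n} [i]_q`. [cite: Lorscheid2018, §1.1.2] -/
def gaussFactorial (q : R) (n : ℕ) : R :=
  ∏ i ∈ range n, gaussNumber q (i + 1)

/-- `[0]_q = 0`. [cite: Lorscheid2018, §1.1.2] -/
@[simp] theorem gaussNumber_zero (q : R) : gaussNumber q 0 = 0 := by
  simp [gaussNumber]

/-- `[m+1]_q = [m]_q + q^m`. [cite: Lorscheid2018, §1.1.2] -/
theorem gaussNumber_succ (q : R) (m : ℕ) : gaussNumber q (m + 1) = gaussNumber q m + q ^ m := by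
  simp [gaussNumber, sum_range_succ]

/-- `[0]_q! = 1`. [cite: Lorscheid2018, §1.1.2] -/
@[simp] theorem gaussFactorial_zero (q : R) : gaussFactorial q 0 = 1 := by
  simp [gaussFactorial]

/-- `[n+1]_q! = [n]_q! · [n+1]_q`. [cite: Lorscheid2018, §1.1.2] -/
theorem gaussFactorial_succ (q : R) (n : ℕ) :
    gaussFactorial q (n + 1) = gaussFactorial q n * gaussNumber q (n + 1) := by
  simp [gaussFactorial, prod_range_succ]

/-- "`lim_{q→1} [n]_q = n`": the value at `q = 1`. [cite: Lorscheid2018, §1.1.2] -/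
theorem gaussNumber_one (m : ℕ) : gaussNumber (1 : R) m = m := by
  simp [gaussNumber]

/-- "`lim_{q→1} [n]_q! = n!`": the value at `q = 1` is `n!`. [cite: Lorscheid2018, §1.1.2] -/
theorem gaussFactorial_one (n : ℕ) : gaussFactorial (1 : R) n = (Nat.factorial n : R) := by
  simp only [gaussFactorial, gaussNumber_one, ← Finset.prod_range_add_one_eq_factorial, Nat.cast_prod,
    Nat.cast_add, Nat.cast_one]

/-- The `ℕ`-valued and the `R`-valued Gauss numbers agree. [cite: Lorscheid2018, §1.1.2] -/
theorem natCast_gaussNumber (q m : ℕ) : ((gaussNumber q m : ℕ) : R) = gaussNumber (q : R) m := by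
  simp [gaussNumber, Nat.cast_sum, Nat.cast_pow]

/-- The `ℕ`-valued and the `R`-valued Gauss factorials agree. [cite: Lorscheid2018, §1.1.2] -/
theorem natCast_gaussFactorial (q n : ℕ) :
    ((gaussFactorial q n : ℕ) : R) = gaussFactorial (q : R) n := by
  simp [gaussFactorial, Nat.cast_prod, natCast_gaussNumber]

end GaussFactorial

/-! ## §2. `∏_{i<n} (qⁿ − q^i) = (q−1)ⁿ q^{n(n−1)/2} [n]_q!` in any commutative ring -/

section Ring

variable {R : Type*} [CommRing R]

/-- `(q − 1) [m]_q = q^m − 1` (geometric sum). [cite: Lorscheid2018, §1.1.2] -/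
theorem sub_one_mul_gaussNumber (q : R) (m : ℕ) : (q - 1) * gaussNumber q m = q ^ m - 1 :=
  mul_geom_sum q m

/-- `qⁿ − q^i = (q − 1) q^i [n−i]_q` for `i ≤ n` (Lorscheid: `qⁿ − q^{i−1} = (q−1) q^{i−1} [i]_q` after
reindexing). [cite: Lorscheid2018, §1.1.2] -/
theorem pow_sub_pow_eq_mul_gaussNumber (q : R) {i n : ℕ} (hi : i ≤ n) :
    q ^ n - q ^ i = (q - 1) * q ^ i * gaussNumber q (n - i) := by
  rw [mul_assoc, mul_left_comm, sub_one_mul_gaussNumber, mul_sub, mul_one, ← pow_add,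
    Nat.add_sub_cancel' hi]

/-- **Lorscheid's display**: `∏_{i<n} (qⁿ − q^i) = (q − 1)ⁿ · q^{n(n−1)/2} · [n]_q!`
("`#GL(n, 𝔽_q) = ∏_{i=1}^{n} (qⁿ − q^{i−1}) = ∏_{i=1}^{n} (q−1) q^{i−1} [i]_q = (q−1)ⁿ q^{(n²−n)/2} [n]_q!`"),
as an identity in any commutative ring. [cite: Lorscheid2018, §1.1.2] -/
theorem prod_pow_sub_pow_eq_gaussFactorial (q : R) (n : ℕ) :
    ∏ i ∈ range n, (q ^ n - q ^ i) = (q - 1) ^ n * q ^ (n * (n - 1) / 2) * gaussFactorial q n := by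
  calc ∏ i ∈ range n, (q ^ n - q ^ i)
      = ∏ i ∈ range n, ((q - 1) * q ^ i * gaussNumber q (n - i)) :=
        prod_congr rfl fun i hi => pow_sub_pow_eq_mul_gaussNumber q (mem_range.mp hi).le
    _ = (q - 1) ^ n * q ^ (n * (n - 1) / 2) * ∏ i ∈ range n, gaussNumber q (n - i) := by
        rw [prod_mul_distrib, prod_mul_distrib, prod_const, card_range, prod_pow_eq_pow_sum,
          Finset.sum_range_id]
    _ = (q - 1) ^ n * q ^ (n * (n - 1) / 2) * gaussFactorial q n := by
        rw [gaussFactorial, ← prod_range_reflect (fun i => gaussNumber q (i + 1)) n]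
        congr 1
        refine prod_congr rfl fun i hi => ?_
        have hi' := mem_range.mp hi
        congr 1
        omega

end Ring

/-! ## §3. `#GL(n, 𝔽_q)`, the diagonal torus, and `#G/#T` -/

section GeneralLinear

variable {𝔽 : Type*} [Field 𝔽] [Fintype 𝔽]

/-- **`#GL(n, 𝔽_q) = (q − 1)ⁿ q^{(n²−n)/2} [n]_q!`** (`q = #𝔽`), from the ordered-bases count
`#GL(n, 𝔽_q) = ∏ (qⁿ − q^i)` (Mathlib `Matrix.card_GL_field`). [cite: Lorscheid2018, §1.1.2] -/
theorem card_GL_eq_gaussFactorial (n : ℕ) :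
    Nat.card (GL (Fin n) 𝔽) =
      (Fintype.card 𝔽 - 1) ^ n * Fintype.card 𝔽 ^ (n * (n - 1) / 2) *
        gaussFactorial (Fintype.card 𝔽) n := by
  have hq : 1 ≤ Fintype.card 𝔽 := Fintype.card_pos
  rw [Matrix.card_GL_field, Fin.prod_univ_eq_prod_range (fun i => Fintype.card 𝔽 ^ n - Fintype.card 𝔽 ^ i) n]
  apply Nat.cast_injective (R := ℤ)
  have h : ∀ i ∈ range n, ((Fintype.card 𝔽 ^ n - Fintype.card 𝔽 ^ i : ℕ) : ℤ) =
      (Fintype.card 𝔽 : ℤ) ^ n - (Fintype.card 𝔽 : ℤ) ^ i := fun i hi => by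
    rw [Nat.cast_sub (Nat.pow_le_pow_right hq (mem_range.mp hi).le), Nat.cast_pow, Nat.cast_pow]
  rw [Nat.cast_prod, prod_congr rfl h, prod_pow_sub_pow_eq_gaussFactorial, Nat.cast_mul, Nat.cast_mul,
    Nat.cast_pow, Nat.cast_pow, Nat.cast_sub hq, Nat.cast_one, natCast_gaussFactorial]

/-- **`#T = (q − 1)ⁿ`** for the diagonal torus `T ≅ (𝔽_qˣ)ⁿ`. [cite: Lorscheid2018, §1.1.2] -/
theorem card_diagonalTorus [DecidableEq 𝔽] (n : ℕ) :
    Fintype.card (Fin n → 𝔽ˣ) = (Fintype.card 𝔽 - 1) ^ n := by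
  rw [Fintype.card_fun, Fintype.card_units, Fintype.card_fin]

/-- **`#GL(n, 𝔽_q) / #T = q^{n(n−1)/2} [n]_q!`** ("if we resolve this zero, i.e. if we divide by
`#T = (q−1)ⁿ`"; exact division in `ℕ`). [cite: Lorscheid2018, §1.1.2] -/
theorem card_GL_div_card_torus [DecidableEq 𝔽] (n : ℕ) :
    Nat.card (GL (Fin n) 𝔽) / Fintype.card (Fin n → 𝔽ˣ) =
      Fintype.card 𝔽 ^ (n * (n - 1) / 2) * gaussFactorial (Fintype.card 𝔽) n := by
  have hq : 1 < Fintype.card 𝔽 := Fintype.one_lt_card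
  rw [card_GL_eq_gaussFactorial, card_diagonalTorus, mul_assoc,
    Nat.mul_div_cancel_left _ (pow_pos (by omega) n)]

end GeneralLinear

/-! ## §4. `lim_{q→1} #G/#T = #S_n`: Tits' `GL(n, 𝔽₁) = S_n` -/

/-- The real polynomial function `x ↦ x^{n(n−1)/2} [n]_x!` (which at `x = q = #𝔽` is `#GL(n,𝔽)/#T`) is
continuous. [cite: Lorscheid2018, §1.1.2] -/
theorem continuous_pow_mul_gaussFactorial (n : ℕ) :
    Continuous fun x : ℝ => x ^ (n * (n - 1) / 2) * gaussFactorial x n := by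
  unfold gaussFactorial gaussNumber
  fun_prop

/-- **`lim_{q→1} #GL(n, 𝔽_q)/#T = #S_n`** in the only sense in which it is a theorem: the polynomial
`q^{n(n−1)/2} [n]_q!` that computes `#G/#T` at prime powers tends to `#S_n = n!` as `q → 1`
("`GL(n, 𝔽_q) ⟶[q → 1] GL(n, 𝔽₁) = S_n`", Tits 1957 as reported by Lorscheid). [cite: Lorscheid2018, §1 (p. 4) and §1.1.2] -/
theorem tendsto_pow_mul_gaussFactorial_card_perm (n : ℕ) :
    Filter.Tendsto (fun x : ℝ => x ^ (n * (n - 1) / 2) * gaussFactorial x n) (nhds 1)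
      (nhds (Fintype.card (Equiv.Perm (Fin n)) : ℝ)) := by
  have h := (continuous_pow_mul_gaussFactorial n).tendsto 1
  beta_reduce at h
  rw [one_pow, one_mul, gaussFactorial_one] at h
  rw [Fintype.card_perm, Fintype.card_fin]
  exact h

/-- The value at `q = 1` itself: `1^{n(n−1)/2} · [n]_1! = n! = #S_n`. [cite: Lorscheid2018, §1.1.2] -/
theorem one_pow_mul_gaussFactorial_one (n : ℕ) :
    (1 : ℕ) ^ (n * (n - 1) / 2) * gaussFactorial 1 n = Fintype.card (Equiv.Perm (Fin n)) := by
  rw [one_pow, one_mul, gaussFactorial_one, Fintype.card_perm, Fintype.card_fin, Nat.cast_id]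

/-! ## §5. Bridge: `[m]_q = [m choose 1]_q`, `[n]_q! = ∏ [i+1 choose 1]_q`, and `#GL_n = #B · #{complete flags}` -/

section Bridge

open Literature.Combinatorics.Enumerative

variable {R : Type*} [CommRing R]

/-- `[m]_q = [m choose 1]_q` (the tree's Gauss binomial, `q`-Pascal form). [cite: Lorscheid2018, §1.1.2] -/
theorem gaussNumber_eq_qBinomial (q : R) (m : ℕ) : gaussNumber q m = qBinomial q m 1 := by
  induction m with
  | zero => simp
  | succ m ih =>
    have h := qBinomial_succ_succ q m 0
    simp only [zero_add, pow_one, qBinomial_zero_right] at h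
    rw [h, ← ih, gaussNumber, gaussNumber, sum_range_succ', pow_zero, mul_sum]
    simp_rw [pow_succ']

/-- `[n]_q! = ∏_{i<n} [i+1 choose 1]_q` — the product by which `GaussianBinomialCount` counts complete
flags. [cite: Lorscheid2018, §1.1.2] -/
theorem gaussFactorial_eq_prod_qBinomial (q : R) (n : ℕ) :
    gaussFactorial q n = ∏ i ∈ range n, qBinomial q (i + 1) 1 := by
  simp only [gaussFactorial, gaussNumber_eq_qBinomial]

end Bridge

section BorelCount

variable {𝔽 : Type*} [Field 𝔽] [Fintype 𝔽]

/-- **`#GL(n, 𝔽_q) = (q − 1)ⁿ q^{n(n−1)/2} · #{complete flags of 𝔽_qⁿ}`**: the count identity behind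
"`#(G/P) = #G/#P`" for `P = B` (the stabiliser of a complete flag has `(q−1)ⁿ q^{n(n−1)/2}` elements),
combining `card_GL_eq_gaussFactorial` with the flag count `card_completeFlag_fin_eq_prod` of
`GaussianBinomialCount`. [cite: Lorscheid2018, §1.1.2] -/
theorem card_GL_eq_card_borel_mul_card_completeFlag (n : ℕ) :
    (Nat.card (GL (Fin n) 𝔽) : ℤ) =
      ((Fintype.card 𝔽 : ℤ) - 1) ^ n * (Fintype.card 𝔽 : ℤ) ^ (n * (n - 1) / 2) *
        Nat.card {c : Fin (n + 1) → Submodule 𝔽 (Fin n → 𝔽) // StrictMono c} := by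
  have hq : 1 ≤ Fintype.card 𝔽 := Fintype.card_pos
  rw [Literature.LinearAlgebra.Subspace.card_completeFlag_fin_eq_prod, Nat.card_eq_fintype_card (α := 𝔽),
    ← gaussFactorial_eq_prod_qBinomial, card_GL_eq_gaussFactorial, Nat.cast_mul, Nat.cast_mul,
    Nat.cast_pow, Nat.cast_pow, Nat.cast_sub hq, Nat.cast_one, natCast_gaussFactorial]

end BorelCount

end Literature.LinearAlgebra.Matrix
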